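import Mathlib
import HarnessLib
import Literature.Probability.Percolation.CornerPercolation
import Literature.Probability.Percolation.QuadCrossingSquareModel
import Literature.Barriers.CriticalPhenomena.EmbeddingModulusUniquenessProofs
import Literature.Probability.RandomPlanarGeometry.ConformalRectangleProofs
import Literature.Probability.RandomPlanarGeometry.SLESixCrossingNondegenerate
import Literature.Probability.RandomPlanarGeometry.ChordalCurveFamily
import Literature.Probability.LatticeModels.IsoradialPercolationProofs
import Literature.Probability.Percolation.DiagonalBoxCrossing

/-!
# Crux `SegmentOpen` (stmt-CriticalPhenomena-5471), line `Sketch` — stub `stub_localUniformRSW`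

The theorem name, namespace, `open` lines and statement are those registered by the lead's
skeleton (`work/SegmentOpen.lean`). Proof: a top–bottom crossing of `w + [0, n] × [0, ρ n]`
(`embTBCrossing`) is sandwiched, on configurations of lattice edges (which carry `M_t`), between
the crude crossings (`embDomainCrossing`, mesh `n⁻¹`) of two fixed test rectangles `rectQuad …`
(walk surgery `walk_passage`); their `M_{t₀}`-probabilities tend to Cardy values in `(0, 1)`
(CardyMod at `(t₀, α₀)` for the sheared partner `Q.map (shearHomeomorph α₀ _)`, uniformizing data
by `MarkedDomain.exists_isUniformizing_holds`, `cardyFunction_mem_Ioo`); UM moves the bounds to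
nearby `t`; lattice periodicity reduces `w` to the cell `[0, √2)²`; the transposition symmetry
of `M_t` turns left–right crossings into top–bottom ones. All [folklore].
-/

noncomputable section

namespace Summit.CriticalPhenomena.CardyFormulaZ2.Theorems

open Literature.Probability Literature.Barriers.CriticalPhenomena
open Literature.Probability.RandomPlanarGeometry (ConformalRectangle ConformalEquiv MarkedDomain)
open Filter Set Topology

section Helpers

open LatticeModels Percolation MeasureTheory SimpleGraph

/-- First entry of a walk into a set `P ∋` its endpoint: the walk starts in `P`, or an initial
piece of it avoiding `P` is followed by an edge into `P`. [folklore] -/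
private theorem walk_first_entry {V : Type*} {G : SimpleGraph V} (P : V → Prop) :
    ∀ {x y : V} (p : G.Walk x y), P y → P x ∨ ∃ (b' b : V) (q : G.Walk x b'), G.Adj b' b ∧
      b ∈ p.support ∧ P b ∧ ∀ v ∈ q.support, v ∈ p.support ∧ ¬ P v
  | _, _, .nil, hy => Or.inl hy
  | x, _, .cons (v := z) hxz p', hy => by
    refine or_iff_not_imp_left.2 fun hx => ?_
    have hx' := (Walk.cons hxz p').start_mem_support
    rcases walk_first_entry P p' hy with hz | ⟨b', b, q, hadj, hb, hPb, hq⟩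
    · refine ⟨x, z, .nil, hxz, List.mem_cons_of_mem _ p'.start_mem_support, hz, fun v hv => ?_⟩
      obtain rfl := List.mem_singleton.1 hv
      exact ⟨hx', hx⟩
    · refine ⟨b', b, .cons hxz q, hadj, List.mem_cons_of_mem _ hb, hPb, fun v hv => ?_⟩
      rcases List.mem_cons.1 hv with rfl | hv
      · exact ⟨hx', hx⟩
      · exact ⟨List.mem_cons_of_mem _ (hq v hv).1, (hq v hv).2⟩

/-- Last exit of a walk from a set `P ∋` its starting point: the walk ends in `P`, or an edge
out of `P` is followed by a final piece avoiding `P`. [folklore] -/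
private theorem walk_last_exit {V : Type*} {G : SimpleGraph V} (P : V → Prop) {x y : V}
    (p : G.Walk x y) (hx : P x) : P y ∨ ∃ (a a' : V) (q : G.Walk a' y), G.Adj a a' ∧
      a ∈ p.support ∧ P a ∧ ∀ v ∈ q.support, v ∈ p.support ∧ ¬ P v := by
  refine (walk_first_entry P p.reverse hx).imp_right fun ⟨b', b, q, hadj, hb, hPb, hq⟩ => ?_
  rw [Walk.support_reverse, List.mem_reverse] at hb
  refine ⟨b, b', q.reverse, hadj.symm, hb, hPb, fun v hv => ?_⟩
  rw [Walk.support_reverse, List.mem_reverse] at hv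
  exact ⟨by simpa using (hq v hv).1, (hq v hv).2⟩

/-- **Passage of a walk across a strip**: a walk from `{f ≤ A}` to `{B ≤ f}` (`A < B`) whose
steps increase `f` by `≤ L` contains such a walk inside `{A - L < f < B + L}`. [folklore] -/
private theorem walk_passage {V : Type*} {G : SimpleGraph V} (f : V → ℝ) {L A B : ℝ}
    (hL : ∀ a b, G.Adj a b → f b ≤ f a + L) (hAB : A < B) {x y : V} (p : G.Walk x y)
    (hx : f x ≤ A) (hy : B ≤ f y) : ∃ (a b : V) (q : G.Walk a b), f a ≤ A ∧ B ≤ f b ∧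
      ∀ v ∈ q.support, v ∈ p.support ∧ A - L < f v ∧ f v < B + L := by
  rcases walk_last_exit (fun v => f v ≤ A) p hx with hy' | ⟨a, a', q₁, hadj, ha, hPa, hq₁⟩
  · exact absurd (hAB.trans_le hy) (not_lt.2 hy')
  rcases walk_first_entry (fun v => B ≤ f v) (Walk.cons hadj q₁) hy with
    hBa | ⟨b', b, q₂, hadj₂, hb, hPb, hq₂⟩
  · exact absurd (hBa.trans hPa) (not_le.2 hAB)
  obtain ⟨h1, h0, h2⟩ : _ ∧ _ ∧ _ :=
    ⟨hL _ _ hadj, hL _ _ hadj.symm, not_le.1 (hq₁ a' q₁.start_mem_support).2⟩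
  have hcons : ∀ v ∈ (Walk.cons hadj q₁).support, v ∈ p.support ∧ A - L < f v := fun v hv => by
    rcases List.mem_cons.1 hv with rfl | hv
    · exact ⟨ha, by linarith⟩
    · exact ⟨(hq₁ v hv).1, by linarith [not_le.1 (hq₁ v hv).2]⟩
  refine ⟨a, b, q₂.concat hadj₂, hPa, hPb, fun v hv => ?_⟩
  rw [Walk.support_concat, List.mem_append, List.mem_singleton] at hv
  rcases hv with hv | rfl
  · exact ⟨(hcons v (hq₂ v hv).1).1, (hcons v (hq₂ v hv).1).2, by linarith [not_le.1 (hq₂ v hv).2]⟩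
  · have h3 := hL _ _ hadj₂
    have h4 := not_le.1 (hq₂ b' q₂.end_mem_support).2
    exact ⟨(hcons v hb).1, by linarith, by linarith⟩

/-- Along an open edge of a configuration of lattice edges the drawn height moves by at most
`2` (in fact `√2`: neighbours of `ℤ²` differ by a unit vector); also `√2 ≤ 2`. [folklore] -/
private theorem open_adj_step {ω : BondConfig (Site 2)} (hω : ω ⊆ (zdGraph 2).edgeSet) :
    Real.sqrt 2 ≤ 2 ∧ ∀ a b : Site 2, (openGraph ω).Adj a b →
      (squareLatticeEmbedding.z b).im ≤ (squareLatticeEmbedding.z a).im + 2 := by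
  have hs : Real.sqrt 2 ≤ 2 := by
    nlinarith [Real.sq_sqrt (show (0:ℝ) ≤ 2 by norm_num), Real.sqrt_nonneg 2]
  refine ⟨hs, fun a b h => ?_⟩
  have hab : (zdGraph 2).Adj a b := by rw [← mem_edgeSet]; exact hω ((openGraph_adj _ _ _).1 h).1
  have h1 : |((b 1 : ℝ) - a 1)| ≤ 1 := by
    rw [zdGraph_adj_iff] at hab
    obtain ⟨i, h | h⟩ := hab <;> subst h <;> fin_cases i <;> simp
  rw [TrackExchange.zsq_im, TrackExchange.zsq_im]
  nlinarith [(abs_le.1 h1).2, Real.sqrt_nonneg 2]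

/-- Comparison of `M_t`-probabilities along an inclusion valid for configurations of lattice
edges (which carry `M_t`, `cornerPercolation_subset_edgeSet`). [folklore] -/
private theorem cornerPercolation_real_mono (t : unitInterval) {X Y : Set (BondConfig (Site 2))}
    (h : ∀ ω : BondConfig (Site 2), ω ⊆ (zdGraph 2).edgeSet → ω ∈ X → ω ∈ Y) :
    (cornerPercolation t).real X ≤ (cornerPercolation t).real Y := by
  rw [measureReal_def, measureReal_def]
  refine ENNReal.toReal_mono (measure_ne_top _ _) (measure_mono_ae ?_)
  filter_upwards [cornerPercolation_subset_edgeSet t] with ω hω using h ω hω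

/-- The vertices drawn at mesh `n⁻¹` in the open rectangle `(x₀, x₁) × (y₀, y₁)` are those
drawn at mesh `1` in `(n x₀, n x₁) × (n y₀, n y₁)`. [folklore] -/
private theorem mem_scaled_rectQuad_iff {x₀ x₁ y₀ y₁ : ℝ} (hx : x₀ < x₁) (hy : y₀ < y₁)
    {n : ℝ} (hn : 0 < n) (p : ℂ) : ((n⁻¹ : ℝ) : ℂ) * p ∈ (rectQuad x₀ x₁ y₀ y₁ hx hy).carrier ↔
      (n * x₀ < p.re ∧ p.re < n * x₁) ∧ n * y₀ < p.im ∧ p.im < n * y₁ := by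
  rw [mem_rectQuad_carrier, Complex.re_ofReal_mul, Complex.im_ofReal_mul, mem_Ioo, mem_Ioo,
    lt_inv_mul_iff₀ hn, inv_mul_lt_iff₀ hn, lt_inv_mul_iff₀ hn, inv_mul_lt_iff₀ hn]

/-- A point drawn at mesh `n⁻¹` within `2 n⁻¹` of a nonempty set on the horizontal line
`im = c` has height within `2` of `n c` at mesh `1`. [folklore] -/
private theorem abs_im_sub_le_of_infDist {p : ℂ} {c n : ℝ} (hn : 0 < n) {S : Set ℂ}
    (hS : S.Nonempty) (h : ∀ q ∈ S, q.im = c)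
    (hd : Metric.infDist (((n⁻¹ : ℝ) : ℂ) * p) S ≤ 2 * n⁻¹) : |p.im - n * c| ≤ 2 := by
  have key : |(((n⁻¹ : ℝ) : ℂ) * p).im - c| ≤ 2 * n⁻¹ := by
    refine ((Metric.le_infDist hS).2 fun q hq => ?_).trans hd
    calc |(((n⁻¹ : ℝ) : ℂ) * p).im - c| = |((((n⁻¹ : ℝ) : ℂ) * p) - q).im| := by
          rw [Complex.sub_im, h q hq]
      _ ≤ _ := (Complex.abs_im_le_norm _).trans (dist_eq_norm _ q).ge
  rw [Complex.im_ofReal_mul, show n⁻¹ * p.im - c = n⁻¹ * (p.im - n * c) by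
    rw [mul_sub, ← mul_assoc, inv_mul_cancel₀ hn.ne', one_mul], abs_mul,
    abs_of_pos (inv_pos.2 hn), mul_comm] at key
  exact le_of_mul_le_mul_right key (inv_pos.2 hn)

/-- **Lower event inclusion.** On configurations of lattice edges, a crude crossing at mesh
`n⁻¹` of `(x₀, x₁) × (y₀, y₁)` — rescaled by `n`: horizontally inside the box
`w + [0, n] × [0, ρ n]`, vertically protruding by `≥ 2` — contains an `embTBCrossing`. [folklore] -/
private theorem embTBCrossing_of_embDomainCrossing {x₀ x₁ y₀ y₁ : ℝ} (hx : x₀ < x₁)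
    (hy : y₀ < y₁) {ρ n : ℝ} (hn : 0 < n) (hρn : 0 < ρ * n) {w : ℂ} (h₁ : w.re ≤ n * x₀)
    (h₂ : n * x₁ ≤ w.re + n) (h₃ : n * y₀ + 2 ≤ w.im) (h₄ : w.im + ρ * n ≤ n * y₁ - 2)
    {ω : BondConfig (Site 2)} (hω : ω ⊆ (zdGraph 2).edgeSet)
    (h : ω ∈ embDomainCrossing squareLatticeEmbedding.z (rectQuad x₀ x₁ y₀ y₁ hx hy).carrier
      n⁻¹ ((rectQuad x₀ x₁ y₀ y₁ hx hy).arc 0) ((rectQuad x₀ x₁ y₀ y₁ hx hy).arc 2)) :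
    ω ∈ embTBCrossing (fun v => squareLatticeEmbedding.z v - w) n (ρ * n) := by
  obtain ⟨u, hu, v, hv, huv⟩ := h
  obtain ⟨p, hp⟩ := mem_openConnIn_iff_exists_openWalk.1 huv
  -- the walk starts below `im w` and ends above `im w + ρ n`
  have hu' := abs_im_sub_le_of_infDist hn ⟨⟨x₀, y₀⟩, (mem_rectQuad_arc_zero hx hy).2
    ⟨rfl, left_mem_Icc.2 hx.le⟩⟩ (fun q hq => ((mem_rectQuad_arc_zero hx hy).1 hq).1) hu
  have hv' := abs_im_sub_le_of_infDist hn ⟨⟨x₀, y₁⟩, (mem_rectQuad_arc_two hx hy).2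
    ⟨rfl, left_mem_Icc.2 hx.le⟩⟩ (fun q hq => ((mem_rectQuad_arc_two hx hy).1 hq).1) hv
  rw [abs_le] at hu' hv'
  obtain ⟨a, b, q, ha, hb, hq⟩ := walk_passage (fun y => (squareLatticeEmbedding.z y).im)
    (open_adj_step hω).2 (by linarith : w.im < w.im + ρ * n) p (by linarith) (by linarith)
  refine ⟨a, ?_, b, ?_, mem_openConnIn_iff_exists_openWalk.2 ⟨q, fun y hy' => ?_⟩⟩
  · show (squareLatticeEmbedding.z a - w).im ≤ 0
    rw [Complex.sub_im]; linarith
  · show ρ * n ≤ (squareLatticeEmbedding.z b - w).im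
    rw [Complex.sub_im]; linarith
  · obtain ⟨hyp, hA, hB⟩ := hq y hy'
    obtain ⟨⟨h5, h6⟩, -, -⟩ := (mem_scaled_rectQuad_iff hx hy hn _).1 (hp y hyp)
    simp only [mem_setOf_eq, Complex.sub_re, Complex.sub_im, mem_Icc]
    exact ⟨⟨by linarith, by linarith⟩, by linarith, by linarith⟩

/-- **Upper event inclusion.** On configurations of lattice edges, a top–bottom crossing of the
box `w + [0, n] × [0, ρ n]` contains a crude crossing at mesh `n⁻¹` of `(x₀, x₁) × (y₀, y₁)` if
the rescaled rectangle protrudes horizontally, is inset vertically, `n (y₁ - y₀) > 4`. [folklore] -/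
private theorem embDomainCrossing_of_embTBCrossing {x₀ x₁ y₀ y₁ : ℝ} (hx : x₀ < x₁)
    (hy : y₀ < y₁) {ρ n : ℝ} (hn : 0 < n) {w : ℂ} (h₁ : n * x₀ < w.re) (h₂ : w.re + n < n * x₁)
    (h₃ : w.im ≤ n * y₀) (h₄ : n * y₁ ≤ w.im + ρ * n) (h₅ : n * y₀ + 4 < n * y₁)
    {ω : BondConfig (Site 2)} (hω : ω ⊆ (zdGraph 2).edgeSet)
    (h : ω ∈ embTBCrossing (fun v => squareLatticeEmbedding.z v - w) n (ρ * n)) :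
    ω ∈ embDomainCrossing squareLatticeEmbedding.z (rectQuad x₀ x₁ y₀ y₁ hx hy).carrier n⁻¹
      ((rectQuad x₀ x₁ y₀ y₁ hx hy).arc 0) ((rectQuad x₀ x₁ y₀ y₁ hx hy).arc 2) := by
  obtain ⟨u, hu, v, hv, huv⟩ := h
  obtain ⟨p, hp⟩ := mem_openConnIn_iff_exists_openWalk.1 huv
  have hu' : (squareLatticeEmbedding.z u - w).im ≤ 0 := hu
  have hv' : ρ * n ≤ (squareLatticeEmbedding.z v - w).im := hv
  rw [Complex.sub_im] at hu' hv'
  obtain ⟨a, b, q, ha, hb, hq⟩ := walk_passage (fun y => (squareLatticeEmbedding.z y).im)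
    (open_adj_step hω).2 (by linarith : n * y₀ + 2 < n * y₁ - 2) p
    (by linarith : _ ≤ n * y₀ + 2) (by linarith : n * y₁ - 2 ≤ _)
  have hre : ∀ y ∈ q.support, n * x₀ < (squareLatticeEmbedding.z y).re ∧
      (squareLatticeEmbedding.z y).re < n * x₁ := fun y hy' => by
    have := hp y (hq y hy').1
    simp only [mem_setOf_eq, Complex.sub_re, mem_Icc] at this
    constructor <;> linarith [this.1.1, this.1.2]
  -- rescaled distances to the bottom and top sides
  have hdist : ∀ (y : Site 2) (c : ℝ) (T : Set ℂ),
      (⟨(((n⁻¹ : ℝ) : ℂ) * squareLatticeEmbedding.z y).re, c⟩ : ℂ) ∈ T →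
      |(squareLatticeEmbedding.z y).im - n * c| ≤ 2 →
      Metric.infDist (((n⁻¹ : ℝ) : ℂ) * squareLatticeEmbedding.z y) T ≤ 2 * n⁻¹ := by
    intro y c T hmem hyc
    refine (Metric.infDist_le_dist_of_mem hmem).trans ?_
    rw [Complex.dist_of_re_eq (z := ((n⁻¹ : ℝ) : ℂ) * squareLatticeEmbedding.z y)
      (w := (⟨(((n⁻¹ : ℝ) : ℂ) * squareLatticeEmbedding.z y).re, c⟩ : ℂ)) rfl,
      Complex.im_ofReal_mul, Real.dist_eq, show n⁻¹ * (squareLatticeEmbedding.z y).im - c =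
        n⁻¹ * ((squareLatticeEmbedding.z y).im - n * c) by
          rw [mul_sub, ← mul_assoc, inv_mul_cancel₀ hn.ne', one_mul], abs_mul,
      abs_of_pos (inv_pos.2 hn), mul_comm]
    exact mul_le_mul_of_nonneg_right hyc (inv_nonneg.2 hn.le)
  have hside : ∀ y ∈ q.support,
      (((n⁻¹ : ℝ) : ℂ) * squareLatticeEmbedding.z y).re ∈ Icc x₀ x₁ := fun y hy' => by
    rw [Complex.re_ofReal_mul]
    exact ⟨((lt_inv_mul_iff₀ hn).2 (hre y hy').1).le, ((inv_mul_lt_iff₀ hn).2 (hre y hy').2).le⟩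
  have haI := (hq a q.start_mem_support).2.1
  have hbI := (hq b q.end_mem_support).2.2
  refine ⟨a, hdist a y₀ _ ((mem_rectQuad_arc_zero hx hy).2 ⟨rfl, hside a q.start_mem_support⟩)
    (abs_le.2 ⟨by linarith, by linarith⟩), b, hdist b y₁ _ ((mem_rectQuad_arc_two hx hy).2
      ⟨rfl, hside b q.end_mem_support⟩) (abs_le.2 ⟨by linarith, by linarith⟩),
    mem_openConnIn_iff_exists_openWalk.2 ⟨q, fun y hy' => ?_⟩⟩
  rw [mem_setOf_eq, mem_scaled_rectQuad_iff hx hy hn]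
  exact ⟨hre y hy', by linarith [(hq y hy').2.1], by linarith [(hq y hy').2.2]⟩

/-- **Lattice periodicity**: translating the box by a lattice vector `z a ∈ √2 ℤ²` does not
change the `M_t`-probability of its crossing (`cornerPercolation_real_openCrossing_shift`).
[folklore] -/
private theorem real_embTBCrossing_shift (t : unitInterval) (a : Site 2) (w : ℂ) (m k : ℝ) :
    (cornerPercolation t).real (embTBCrossing
        (fun v => squareLatticeEmbedding.z v - (squareLatticeEmbedding.z a + w)) m k) =
      (cornerPercolation t).real (embTBCrossing (fun v => squareLatticeEmbedding.z v - w) m k) := by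
  have key : ∀ v : Site 2, squareLatticeEmbedding.z v - (squareLatticeEmbedding.z a + w) =
      squareLatticeEmbedding.z (v + -a) - w := fun v => by
    apply Complex.ext <;> simp [TrackExchange.zsq_re, TrackExchange.zsq_im] <;> ring
  have e : ∀ P : ℂ → Prop,
      {v : Site 2 | P (squareLatticeEmbedding.z v - (squareLatticeEmbedding.z a + w))} =
        (· + a) '' {v : Site 2 | P (squareLatticeEmbedding.z v - w)} := fun P => by
    ext v; simp only [Set.image_add_right, mem_preimage, mem_setOf_eq, key]
  simp only [embTBCrossing]
  rw [e (fun p => p.re ∈ Icc 0 m ∧ p.im ∈ Icc (-2) (k + 2)), e (fun p => p.im ≤ 0),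
    e (fun p => k ≤ p.im), cornerPercolation_real_openCrossing_shift]

/-- Every `w ∈ ℂ` is a lattice vector of `√2 ℤ²` plus a vector of the cell `[0, √2)²`.
[folklore] -/
private theorem exists_cell_translate (w : ℂ) :
    ∃ (a : Site 2) (w' : ℂ), w = squareLatticeEmbedding.z a + w' ∧
      0 ≤ w'.re ∧ w'.re < Real.sqrt 2 ∧ 0 ≤ w'.im ∧ w'.im < Real.sqrt 2 := by
  have hs : 0 < Real.sqrt 2 := by positivity
  have hf : ∀ r : ℝ,
      r = Real.sqrt 2 * ⌊r / Real.sqrt 2⌋ + Real.sqrt 2 * Int.fract (r / Real.sqrt 2) ∧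
      0 ≤ Real.sqrt 2 * Int.fract (r / Real.sqrt 2) ∧
      Real.sqrt 2 * Int.fract (r / Real.sqrt 2) < Real.sqrt 2 := fun r =>
    ⟨by rw [← mul_add, Int.floor_add_fract, mul_div_cancel₀ _ hs.ne'],
      mul_nonneg hs.le (Int.fract_nonneg _), mul_lt_of_lt_one_right hs (Int.fract_lt_one _)⟩
  refine ⟨![⌊w.re / Real.sqrt 2⌋, ⌊w.im / Real.sqrt 2⌋],
    ⟨Real.sqrt 2 * Int.fract (w.re / Real.sqrt 2), Real.sqrt 2 * Int.fract (w.im / Real.sqrt 2)⟩,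
    ?_, (hf w.re).2.1, (hf w.re).2.2, (hf w.im).2.1, (hf w.im).2.2⟩
  apply Complex.ext
  · simpa [TrackExchange.zsq_re] using (hf w.re).1
  · simpa [TrackExchange.zsq_im] using (hf w.im).1

/-- **Left–right crossings are transposed top–bottom crossings** (invariance of `M_t` under the
transposition of the axes, `cornerPercolation_real_preimage_relabel_transpose`):
`M_t(LR(w + [0, m] × [0, k])) = M_t(TB(wᵀ + [0, k] × [0, m]))`, `wᵀ = (im w, re w)`. [folklore] -/
private theorem real_embRectCrossing_eq (t : unitInterval) (w : ℂ) (m k : ℝ) :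
    (cornerPercolation t).real (embRectCrossing (fun v => squareLatticeEmbedding.z v - w) m k) =
      (cornerPercolation t).real
        (embTBCrossing (fun v => squareLatticeEmbedding.z v - ⟨w.im, w.re⟩) k m) := by
  rw [← cornerPercolation_real_preimage_relabel_transpose t (embTBCrossing _ k m)]
  have e : ∀ P : ℝ → ℝ → Prop, (transposeIso.toEquiv : Site 2 ≃ Site 2) ''
      {v : Site 2 | P (squareLatticeEmbedding.z v - w).re (squareLatticeEmbedding.z v - w).im} =
        {v : Site 2 | P (squareLatticeEmbedding.z v - ⟨w.im, w.re⟩).im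
          (squareLatticeEmbedding.z v - ⟨w.im, w.re⟩).re} := fun P => by
    rw [show ((transposeIso.toEquiv : Site 2 ≃ Site 2) '' {v : Site 2 |
        P (squareLatticeEmbedding.z v - w).re (squareLatticeEmbedding.z v - w).im}) =
        (transposeIso : Site 2 → Site 2) '' {v : Site 2 |
          P (squareLatticeEmbedding.z v - w).re (squareLatticeEmbedding.z v - w).im} from rfl,
      image_transposeIso]
    ext v
    simp only [mem_preimage, mem_setOf_eq, Complex.sub_re, Complex.sub_im,
      TrackExchange.zsq_re, TrackExchange.zsq_im, transposeIso_apply_zero, transposeIso_apply_one]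
  congr 1
  calc embRectCrossing (fun v => squareLatticeEmbedding.z v - w) m k
      = openCrossing {v | (fun a b => a ∈ Icc (-2) (m + 2) ∧ b ∈ Icc 0 k)
            (squareLatticeEmbedding.z v - w).re (squareLatticeEmbedding.z v - w).im}
          {v | (fun a _ => a ≤ 0) (squareLatticeEmbedding.z v - w).re
            (squareLatticeEmbedding.z v - w).im}
          {v | (fun a _ => m ≤ a) (squareLatticeEmbedding.z v - w).re
            (squareLatticeEmbedding.z v - w).im} := rfl
    _ = _ := (preimage_relabel_openCrossing transposeIso.toEquiv _ _ _).symm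
    _ = _ := by
      rw [e (fun a b => a ∈ Icc (-2) (m + 2) ∧ b ∈ Icc 0 k), e (fun a _ => a ≤ 0),
        e (fun a _ => m ≤ a)]
      simp only [embTBCrossing]
      congr 2
      exact Set.ext fun v => and_comm

/-- If `P_{t₀}(Q, δ) → L` as `δ → 0⁺` and `t ↦ P_t(Q, δ)` is equicontinuous at `t₀` uniformly in
`δ` (UM for `Q`), then `|P_t(Q, δ) - L| < 2ε` for `t` near `t₀` and `δ` small. [folklore] -/
private theorem crossingProb_near_limit {t₀ : unitInterval} {Q : ConformalRectangle} {L ε : ℝ}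
    (hε : 0 < ε) (hT : Tendsto (cornerCrossingProb t₀ Q) (𝓝[>] 0) (𝓝 L))
    (hU : ∃ η > 0, ∀ t : unitInterval, dist t t₀ < η → ∀ δ : ℝ, 0 < δ →
      |cornerCrossingProb t Q δ - cornerCrossingProb t₀ Q δ| < ε) :
    ∃ δ₀ > 0, ∃ η > 0, ∀ t : unitInterval, dist t t₀ < η → ∀ δ : ℝ, 0 < δ → δ < δ₀ →
      L - 2 * ε < cornerCrossingProb t Q δ ∧ cornerCrossingProb t Q δ < L + 2 * ε := by
  obtain ⟨δ₀, hδ₀, hP⟩ := Metric.tendsto_nhdsWithin_nhds.1 hT ε hε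
  obtain ⟨η, hη, hU⟩ := hU
  refine ⟨δ₀, hδ₀, η, hη, fun t ht δ hδ hδ' => ?_⟩
  have h1 : dist (cornerCrossingProb t₀ Q δ) L < ε :=
    hP hδ (by rwa [dist_zero_right, Real.norm_of_nonneg hδ.le])
  rw [Real.dist_eq, abs_lt] at h1
  have h2 := abs_lt.1 (hU t ht δ hδ)
  constructor <;> linarith

end Helpers

/-- S3 (L; uniformizing data exist by the tree's PROVED
`MarkedDomain.exists_isUniformizing_holds`, `ConformalRectangleProofs`). LOCAL UNIFORM RSW:
UM and a Cardy point `(t₀, α₀)` give box-crossing bounds for `M_t`, uniform in `t` near `t₀`: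
compare `embRectCrossing`/`embTBCrossing` of the box `w + [0, ρ n] × [0, n]` with the crude
crossings (`embDomainCrossing`) of fixed axis-parallel rectangles (`rectQuad`, mapped by
`shearHomeomorph α₀` to get the sheared partner), whose `M_{t₀}`-limits are Cardy values in
`(0, 1)` (`cardyFunction_mem_Ioo`); lattice periodicity (`cornerPercolation_map_relabel_shift`)
reduces the translation `w` to a fundamental cell; UM moves the bounds from `t₀` to nearby `t`. -/
theorem stub_localUniformRSW :
    (∀ (t₀ : unitInterval) (R : ConformalRectangle) (ε : ℝ), 0 < ε → ∃ η > 0, ∀ t : unitInterval,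
      dist t t₀ < η → ∀ δ : ℝ, 0 < δ →
        |Percolation.cornerCrossingProb t R δ - Percolation.cornerCrossingProb t₀ R δ| < ε) →
    ∀ (t₀ : unitInterval) (α₀ : ℂ), 0 < α₀.im →
      (∀ (R R' : ConformalRectangle)
        (φ : ConformalEquiv UpperHalfPlane.upperHalfPlaneSet R.carrier) (x : Fin 4 → ℝ),
        R.carrier = moduliShear α₀ '' R'.carrier → (∀ i, R.pt i = moduliShear α₀ (R'.pt i)) →
        R.IsUniformizing φ x →
        Tendsto (Percolation.cornerCrossingProb t₀ R') (𝓝[>] 0)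
          (𝓝 (RandomPlanarGeometry.cardyFunction (RandomPlanarGeometry.crossRatio x)))) →
      ∀ ρ : ℝ, 0 < ρ → ∃ c > 0, ∃ n₀ : ℕ, ∃ η > 0, ∀ t : unitInterval, dist t t₀ < η →
        LatticeModels.BoxCrossingBounds (Percolation.cornerPercolation t)
          LatticeModels.squareLatticeEmbedding.z ρ c n₀ := by
  intro hUM t₀ α₀ hα hCardy ρ hρ
  -- Cardy limits in `(0, 1)` for every conformal rectangle, via the sheared partner
  have hlim : ∀ Q : ConformalRectangle, ∃ L : ℝ, L ∈ Ioo (0 : ℝ) 1 ∧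
      Tendsto (Percolation.cornerCrossingProb t₀ Q) (𝓝[>] 0) (𝓝 L) := fun Q => by
    obtain ⟨φ, x, hφ⟩ :=
      MarkedDomain.exists_isUniformizing_holds (Q.map (shearHomeomorph α₀ hα.ne'))
    exact ⟨_, RandomPlanarGeometry.cardyFunction_mem_Ioo
      (ConformalRectangle.crossRatio_mem_Ioo_of_isUniformizing hφ),
      hCardy _ Q φ x (by rw [MarkedDomain.carrier_map, coe_shearHomeomorph])
        (fun i => by rw [MarkedDomain.pt_map, coe_shearHomeomorph]) hφ⟩
  -- test rectangles `Q_L = (1/3, 2/3) × (-1, ρ + 1)` (lower bound), `Q_U = (-1, 2) × (ρ/3, 2ρ/3)`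
  have hxL : (1 / 3 : ℝ) < 2 / 3 := by norm_num
  have hyL : (-1 : ℝ) < ρ + 1 := by linarith
  have hxU : (-1 : ℝ) < 2 := by norm_num
  have hyU : ρ / 3 < 2 * ρ / 3 := by linarith
  obtain ⟨LL, hLL, hTL⟩ := hlim (Percolation.rectQuad _ _ _ _ hxL hyL)
  obtain ⟨LU, hLU, hTU⟩ := hlim (Percolation.rectQuad _ _ _ _ hxU hyU)
  have hεL : 0 < LL / 4 := by linarith [hLL.1]
  have hεU : 0 < (1 - LU) / 4 := by linarith [hLU.2]
  obtain ⟨δL, hδL, ηL, hηL, hPL⟩ :=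
    crossingProb_near_limit hεL hTL (hUM t₀ (Percolation.rectQuad _ _ _ _ hxL hyL) _ hεL)
  obtain ⟨δU, hδU, ηU, hηU, hPU⟩ :=
    crossingProb_near_limit hεU hTU (hUM t₀ (Percolation.rectQuad _ _ _ _ hxU hyU) _ hεU)
  obtain ⟨n₀, hn₀⟩ := Filter.eventually_atTop.1 <|
    ((tendsto_natCast_atTop_atTop (R := ℝ)).eventually_gt_atTop (max 7 (13 / ρ))).and <|
      ((tendsto_inv_atTop_nhds_zero_nat (𝕜 := ℝ)).eventually (gt_mem_nhds hδL)).and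
        ((tendsto_inv_atTop_nhds_zero_nat (𝕜 := ℝ)).eventually (gt_mem_nhds hδU))
  refine ⟨min (LL / 2) ((1 - LU) / 2), lt_min (by linarith [hLL.1]) (by linarith [hLU.2]), n₀,
    min ηL ηU, lt_min hηL hηU, fun t ht n hn w => ?_⟩
  obtain ⟨h7, hnL, hnU⟩ := hn₀ n hn
  obtain ⟨htL, htU⟩ := lt_min_iff.1 ht
  obtain ⟨h7, h13⟩ := max_lt_iff.1 h7
  have hn' : (0 : ℝ) < n := by linarith
  rw [div_lt_iff₀ hρ] at h13
  have hs2 : Real.sqrt 2 ≤ 2 := (open_adj_step (ω := ∅) (Set.empty_subset _)).1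
  -- the two bounds for top–bottom crossings of `w + [0, n] × [0, ρ n]`, for every `w`
  have key : ∀ w : ℂ, min (LL / 2) ((1 - LU) / 2) ≤ (Percolation.cornerPercolation t).real
      (LatticeModels.embTBCrossing (fun v => LatticeModels.squareLatticeEmbedding.z v - w)
        n (ρ * n)) ∧ (Percolation.cornerPercolation t).real (LatticeModels.embTBCrossing
        (fun v => LatticeModels.squareLatticeEmbedding.z v - w) n (ρ * n)) ≤
      1 - min (LL / 2) ((1 - LU) / 2) := fun w => by
    obtain ⟨a, w', rfl, h0, h1, h2, h3⟩ := exists_cell_translate w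
    rw [real_embTBCrossing_shift]
    constructor
    · calc min (LL / 2) ((1 - LU) / 2) ≤ LL / 2 := min_le_left _ _
        _ ≤ Percolation.cornerCrossingProb t (Percolation.rectQuad _ _ _ _ hxL hyL) (n : ℝ)⁻¹ := by
          linarith [(hPL t htL _ (inv_pos.2 hn') hnL).1]
        _ = _ := Percolation.cornerCrossingProb_eq _ _ _
        _ ≤ _ := cornerPercolation_real_mono t fun ω hω hX =>
          embTBCrossing_of_embDomainCrossing hxL hyL hn' (by positivity) (by linarith)
            (by linarith) (by linarith) (by linarith) hω hX
    · calc (Percolation.cornerPercolation t).real (LatticeModels.embTBCrossing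
            (fun v => LatticeModels.squareLatticeEmbedding.z v - w') n (ρ * n))
          ≤ _ := cornerPercolation_real_mono t fun ω hω hX =>
            embDomainCrossing_of_embTBCrossing hxU hyU hn' (by linarith) (by linarith)
              (by linarith) (by linarith) (by linarith) hω hX
        _ = Percolation.cornerCrossingProb t (Percolation.rectQuad _ _ _ _ hxU hyU) (n : ℝ)⁻¹ :=
          (Percolation.cornerCrossingProb_eq _ _ _).symm
        _ ≤ 1 - (1 - LU) / 2 := by linarith [(hPU t htU _ (inv_pos.2 hn') hnU).2]
        _ ≤ 1 - min (LL / 2) ((1 - LU) / 2) := by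
          linarith [min_le_right (LL / 2) ((1 - LU) / 2)]
  exact ⟨by rw [real_embRectCrossing_eq]; exact key _, key w⟩

end Summit.CriticalPhenomena.CardyFormulaZ2.Theorems
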